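import Summits.RiemannHypothesis.RiemannHypothesis.Theorems.PfPersistenceM2EvenSectorIndexExact
import HarnessLib

/-!
# PF-persistence, M2 seat (gen 6), part 1/3: bystander control for tuned symmetric translates

pub-rhpf cell, M2 seat, generation 6.  HONEST FRAMING (page 1 of everything in this cell): a long-odds
MECHANISM SEARCH around Weil's quadratic functional; NOTHING here claims, approaches or conditionally proves RH.
Labels: PROVED = kernel-checked; CITED = in print (Bombieri 2000, Rend. Lincei (9) 11, Thms 9–11).

Four small lemmas feeding part 2 (`PfPersistenceM2EvenSectorIndexAccumulation`, the localisation of gen 5's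
"negative even index `≥ K`" to finitely many zeros with `Re ρ ≥ 1/2 + θ`), all RH-free:
* `re_weilMellin_eq_zero_of_far` — LOCALISED symmetry transport: for an even real test `g`, if `Re ĝ` vanishes at
  the non-trivial zeros with `Re ρ ≥ 1/2 + θ`, `Im ρ > 0`, then `Re ĝ(ρ) = 0` at every non-trivial zero with
  `|Re ρ - 1/2| ≥ θ` (gen 5's `re_weilMellin_eq_zero_of_quadrant` is the case "all off-line zeros");
* `norm_coshFactor_le_cosh` — the transform factor `(e^{(s-1/2)T} + e^{-(s-1/2)T})/2` of a symmetric translate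
  has modulus `≤ cosh((Re s - 1/2)T)` (gen 5 only used `≤ 1` on the line);
* `cosh_add_le_exp_mul_cosh` — `cosh(a+b) ≤ e^b cosh a` (`b ≥ 0`), comparing tuned lengths in `[T, T + C]`;
* `tendsto_cosh_div_cosh_atTop` — `cosh(xT)/cosh(θT) → 0` for `|x| < θ`: an off-line BYSTANDER zero closer to
  the line than the targets is amplified negligibly relative to the targets.
Reused by name: gen 4 `weilMellin_conj`, `RuelleBandExactFirstBandStubEvenTransfer/ExpSum`
(`stub_evenTransfer_conj_weilMellin`, `weilMellin_one_sub_of_even`).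
-/

noncomputable section

set_option linter.dupNamespace false

open Complex Filter Set MeasureTheory
open scoped Real Topology ComplexConjugate BigOperators

namespace Summit.RiemannHypothesis.RiemannHypothesis.Theorems.PfPersistenceM2NegIndex

open Literature.NumberTheory.LFunctions
open Literature.NumberTheory.LFunctions.ZetaZeros
open Summit.RiemannHypothesis.RiemannHypothesis.Theorems.RuelleBandExactFirstBand
  (stub_evenTransfer_conj_weilMellin weilMellin_one_sub_of_even)


/-! ## F. Localisation in the real part -/

/-- Localised re-part transport: for an even real `g`, if `Re ĝ` vanishes on a set `Z` containing every
non-trivial zero with `Re ρ ≥ 1/2 + θ`, `Im ρ > 0`, then `Re ĝ(ρ) = 0` at every non-trivial zero with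
`|Re ρ - 1/2| ≥ θ` (`ĝ` takes the values `x, x̄, x, x̄` on `ρ, ρ̄, 1-ρ, 1-ρ̄`). [cite: Bombieri2000Weil, Thm 9] -/
theorem re_weilMellin_eq_zero_of_far {g : ℝ → ℂ} (heven : ∀ t : ℝ, g (-t) = g t)
    (hreal : ∀ t : ℝ, (g t).im = 0) {θ : ℝ} {Z : Set ℂ}
    (hZ : ∀ ρ ∈ riemannZetaNontrivialZeros, 1 / 2 + θ ≤ ρ.re → 0 < ρ.im → ρ ∈ Z)
    (hvan : ∀ ρ ∈ Z, (weilMellin g ρ).re = 0) {ρ : ℂ} (hρ : ρ ∈ riemannZetaNontrivialZeros)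
    (hfar : θ ≤ |ρ.re - 1 / 2|) : (weilMellin g ρ).re = 0 := by
  have him : ρ.im ≠ 0 := riemannZetaNontrivialZeros.im_ne_zero hρ
  rcases le_abs'.1 hfar with hlt | hgt
  · rcases lt_or_gt_of_ne him with hneg | hpos
    · have hmem : 1 - ρ ∈ riemannZetaNontrivialZeros := by
        simpa using riemannZetaNontrivialZeros.one_sub_conj_mem (riemannZetaNontrivialZeros.conj_mem hρ)
      have h1 := hvan _ (hZ _ hmem (by simp only [Complex.sub_re, Complex.one_re]; linarith)
        (by simp only [Complex.sub_im, Complex.one_im]; linarith))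
      rwa [weilMellin_one_sub_of_even heven] at h1
    · have hmem := riemannZetaNontrivialZeros.one_sub_conj_mem hρ
      have h1 := hvan _ (hZ _ hmem (by simp only [Complex.sub_re, Complex.one_re, Complex.conj_re]; linarith)
        (by simp only [Complex.sub_im, Complex.one_im, Complex.conj_im]; linarith))
      rwa [← stub_evenTransfer_conj_weilMellin heven hreal, Complex.conj_re] at h1
  · rcases lt_or_gt_of_ne him with hneg | hpos
    · have hmem := riemannZetaNontrivialZeros.conj_mem hρ
      have h1 := hvan _ (hZ _ hmem (by simp only [Complex.conj_re]; linarith)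
        (by simp only [Complex.conj_im]; linarith))
      rwa [weilMellin_conj heven hreal, Complex.conj_re] at h1
    · exact hvan _ (hZ _ hρ (by linarith) hpos)

/-- Off the line the transform factor of a symmetric translate by `T` has modulus at most `cosh((Re s - 1/2)T)`
(`|e^{w} + e^{-w}| ≤ e^{Re w} + e^{-Re w}`). [folklore] -/
theorem norm_coshFactor_le_cosh (s : ℂ) (T : ℝ) :
    ‖(cexp ((s - 1 / 2) * T) + cexp (-((s - 1 / 2) * T))) / 2‖ ≤ Real.cosh ((s.re - 1 / 2) * T) := by
  have hre : ((s - 1 / 2) * (T : ℂ)).re = (s.re - 1 / 2) * T := by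
    simp [Complex.mul_re]
  have h1 : ‖cexp ((s - 1 / 2) * T)‖ = Real.exp ((s.re - 1 / 2) * T) := by
    rw [Complex.norm_exp, hre]
  have h2 : ‖cexp (-((s - 1 / 2) * T))‖ = Real.exp (-((s.re - 1 / 2) * T)) := by
    rw [Complex.norm_exp, Complex.neg_re, hre]
  rw [norm_div, RCLike.norm_two, Real.cosh_eq]
  have h3 := norm_add_le (cexp ((s - 1 / 2) * T)) (cexp (-((s - 1 / 2) * T)))
  rw [h1, h2] at h3
  linarith

/-- `cosh(a + b) ≤ e^{b} cosh a` for `b ≥ 0`. [folklore] -/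
theorem cosh_add_le_exp_mul_cosh (a : ℝ) {b : ℝ} (hb : 0 ≤ b) :
    Real.cosh (a + b) ≤ Real.exp b * Real.cosh a := by
  rw [Real.cosh_add, ← Real.cosh_add_sinh b]
  have h1 : Real.sinh a ≤ Real.cosh a := (Real.sinh_lt_cosh a).le
  have h2 : 0 ≤ Real.sinh b := Real.sinh_nonneg_iff.2 hb
  nlinarith [mul_le_mul_of_nonneg_right h1 h2]

/-- For `|x| < θ`: `cosh(xT)/cosh(θT) → 0` as `T → +∞` (it is `≤ 2e^{-(θ - |x|)T}`). [folklore] -/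
theorem tendsto_cosh_div_cosh_atTop {x θ : ℝ} (hx : |x| < θ) :
    Tendsto (fun T : ℝ ↦ Real.cosh (x * T) / Real.cosh (θ * T)) atTop (𝓝 0) := by
  have hpos : 0 < θ - |x| := sub_pos.2 hx
  have hlim : Tendsto (fun T : ℝ ↦ 2 * Real.exp (-((θ - |x|) * T))) atTop (𝓝 0) := by
    have h := (Real.tendsto_exp_neg_atTop_nhds_zero.comp (tendsto_id.const_mul_atTop hpos)).const_mul 2
    simpa using h
  refine tendsto_of_tendsto_of_tendsto_of_le_of_le' tendsto_const_nhds hlim ?_ ?_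
  · exact Eventually.of_forall fun T ↦ div_nonneg (Real.cosh_pos _).le (Real.cosh_pos _).le
  · filter_upwards [eventually_ge_atTop 0] with T hT
    have h1 : Real.cosh (x * T) ≤ Real.exp (|x| * T) := by
      rw [← Real.cosh_abs, abs_mul, abs_of_nonneg hT, ← Real.cosh_add_sinh]
      linarith [Real.sinh_nonneg_iff.2 (mul_nonneg (abs_nonneg x) hT)]
    have h2 : Real.exp (θ * T) / 2 ≤ Real.cosh (θ * T) := by
      rw [Real.cosh_eq]
      linarith [Real.exp_pos (-(θ * T))]
    have h3 : 2 * Real.exp (-((θ - |x|) * T)) * (Real.exp (θ * T) / 2) = Real.exp (|x| * T) := by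
      rw [show 2 * Real.exp (-((θ - |x|) * T)) * (Real.exp (θ * T) / 2) =
          Real.exp (-((θ - |x|) * T)) * Real.exp (θ * T) by ring, ← Real.exp_add]
      congr 1
      ring
    rw [div_le_iff₀ (Real.cosh_pos _)]
    calc Real.cosh (x * T) ≤ Real.exp (|x| * T) := h1
      _ = 2 * Real.exp (-((θ - |x|) * T)) * (Real.exp (θ * T) / 2) := h3.symm
      _ ≤ 2 * Real.exp (-((θ - |x|) * T)) * Real.cosh (θ * T) :=
          mul_le_mul_of_nonneg_left h2 (by positivity)

end Summit.RiemannHypothesis.RiemannHypothesis.Theorems.PfPersistenceM2NegIndex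

end
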